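import Summits.Ventures.HodgeRepro2.T5InertGlobalPrime
import Summits.Ventures.HodgeRepro2.T5InertPlaceCompletionIsotropy

/-!
# T5InertPlaceGlobalPackage — the inert-place package on the record's local fields from the
GLOBAL data «`v` stays prime in the quadratic `L / K`»

Tier-5 kernel support (N3, the inert places) — p8, gen 15.  §8(d): uses an L-value-free
non-vanishing device: NO.

Every inert-place statement on Mathlib's completions so far (`T5InertPlaceCompletion`,
`T5InertPlaceCompletionLattice`, `T5InertPlaceCompletionIsotropy`) took the LOCAL hypotheses
`[L_w : K_v] = 2` and «`ϖ` stays a uniformiser» as given.  With `T5InertGlobalToLocal` / `T5InertGlobalPrime` they follow from two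
global facts — `[L : K] = 2` and `v 𝒪_L = w` — so the package is restated here with exactly those
two hypotheses (plus the Galois conjugation `σ ≠ 1`, which exists by
`T5InertGlobalPrime.exists_algEquiv_ne_one_of_staysPrime`, and the hermitian data):
* `exists_isInteger_conj_mul_eq_unit_of_staysPrime` — the norm theorem for units
  `N(𝒪_{E_v}^×) = 𝒪_{F_v}^×`;
* `exists_isotropic_of_staysPrime` — every `σ`-hermitian `3 × 3` matrix over `L_w` with unit
  determinant has a non-zero isotropic vector;
* `heckeAlgebra_mul_comm_of_staysPrime` — `H(U(H), K_H)` is commutative for every unimodular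
  hermitian `3 × 3` matrix `H` over `L_w` with integral entries and inverse;
* `exists_dualLattice_eq_iff_of_staysPrime` / `…'` — (u3) verbatim: `(L_w³, H)` admits a self-dual
  lattice over `𝒪_{E_v} = integralClosure O_Kv L_w` (resp. over Mathlib's `O_Lw`) iff `det H` has
  even valuation, i.e. `det H = a · ϖ^{2m}` with `a ∈ O_Kvˣ`, for every `σ`-hermitian `H` with
  unit determinant (no isotropy hypothesis).

Nothing here asserts which places of the datum's `F` are inert in `E`, which `H` is the datum's
Gram matrix, or which self-dual lattice the record takes.
-/

namespace Summit.Ventures.HodgeRepro2.T5InertPlaceGlobalPackage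

open IsDedekindDomain HeightOneSpectrum NumberField

variable {K : Type*} [Field K] [NumberField K] (v : HeightOneSpectrum (RingOfIntegers K))
variable {L : Type*} [Field L] [NumberField L] [Algebra K L]
  (w : HeightOneSpectrum (RingOfIntegers L)) [w.asIdeal.LiesOver v.asIdeal]

/-- THE NORM THEOREM FOR UNITS at a place `v` that stays prime in the quadratic `L / K`: every unit
of `O_Kv` is `σ z · z` with `z` integral over `O_Kv` in `L_w`
(`T5InertPlaceCompletionIsotropy.exists_isInteger_conj_mul_eq_unit_adicCompletion`). -/
theorem exists_isInteger_conj_mul_eq_unit_of_staysPrime (h2 : Module.finrank K L = 2)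
    (hmap : v.asIdeal.map (algebraMap (𝓞 K) (𝓞 L)) = w.asIdeal)
    {ϖ : v.adicCompletionIntegers K} (hϖ : Irreducible ϖ)
    (σ : w.adicCompletion L ≃ₐ[v.adicCompletion K] w.adicCompletion L) (hσ : σ ≠ 1)
    (u : (v.adicCompletionIntegers K)ˣ) :
    ∃ z : w.adicCompletion L,
      IsLocalization.IsInteger (integralClosure (v.adicCompletionIntegers K) (w.adicCompletion L)) z ∧
        σ z * z = algebraMap (v.adicCompletionIntegers K) (w.adicCompletion L) u :=
  T5InertPlaceCompletionIsotropy.exists_isInteger_conj_mul_eq_unit_adicCompletion v w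
    (T5InertGlobalPrime.finrank_adicCompletion_eq_two_of_staysPrime v w h2 hmap) hϖ
    (T5InertGlobalPrime.irreducible_algebraMap_of_staysPrime v w hmap hϖ) σ hσ u

/-- THE ISOTROPY OF `V_v` at a place `v` that stays prime in the quadratic `L / K`: every
`σ`-hermitian `3 × 3` matrix over `L_w` with unit determinant has a non-zero isotropic vector
(`T5InertPlaceCompletionIsotropy.exists_isotropic_adicCompletion`). -/
theorem exists_isotropic_of_staysPrime (h2 : Module.finrank K L = 2)
    (hmap : v.asIdeal.map (algebraMap (𝓞 K) (𝓞 L)) = w.asIdeal)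
    {ϖ : v.adicCompletionIntegers K} (hϖ : Irreducible ϖ)
    (σ : w.adicCompletion L ≃ₐ[v.adicCompletion K] w.adicCompletion L) (hσ : σ ≠ 1) :
    letI := T5StarOfInvolution.starRingOfQuadratic
      (T5InertGlobalPrime.finrank_adicCompletion_eq_two_of_staysPrime v w h2 hmap) σ hσ
    ∀ {H : Matrix (Fin 3) (Fin 3) (w.adicCompletion L)}, H.IsHermitian → IsUnit H.det →
      ∃ x : Fin 3 → w.adicCompletion L, x ≠ 0 ∧ T5UnitaryGroupIsometry.sesqForm H x x = 0 :=
  T5InertPlaceCompletionIsotropy.exists_isotropic_adicCompletion v w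
    (T5InertGlobalPrime.finrank_adicCompletion_eq_two_of_staysPrime v w h2 hmap) hϖ
    (T5InertGlobalPrime.irreducible_algebraMap_of_staysPrime v w hmap hϖ) σ hσ

/-- `H(U(H), K_H)` is commutative at a place `v` that stays prime in the quadratic `L / K`
(`T5InertPlaceCompletion.heckeAlgebra_mul_comm_adicCompletion` with its two local hypotheses
discharged from `[L : K] = 2` and `v 𝒪_L = w`). -/
theorem heckeAlgebra_mul_comm_of_staysPrime (h2 : Module.finrank K L = 2)
    (hmap : v.asIdeal.map (algebraMap (𝓞 K) (𝓞 L)) = w.asIdeal)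
    {ϖ : v.adicCompletionIntegers K} (hϖ : Irreducible ϖ)
    (σ : w.adicCompletion L ≃ₐ[v.adicCompletion K] w.adicCompletion L) (hσ : σ ≠ 1) :
    letI := T5StarOfInvolution.starRingOfQuadratic
      (T5InertGlobalPrime.finrank_adicCompletion_eq_two_of_staysPrime v w h2 hmap) σ hσ
    ∀ (H : Matrix (Fin 3) (Fin 3) (w.adicCompletion L)) (k : Type*) [Field k],
      H.IsHermitian →
      (∀ i j, IsLocalization.IsInteger
        (integralClosure (v.adicCompletionIntegers K) (w.adicCompletion L)) (H i j)) →
      IsUnit H.det →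
      (∀ i j, IsLocalization.IsInteger
        (integralClosure (v.adicCompletionIntegers K) (w.adicCompletion L)) (H⁻¹ i j)) →
      ∀ (T S : T5HeckePermutationModule.heckeAlgebra k (T5UnitaryHeckeAdjoint.hyperspecialSubgroup
        (integralClosure (v.adicCompletionIntegers K) (w.adicCompletion L)) H)),
      T * S = S * T :=
  T5InertPlaceCompletionIsotropy.heckeAlgebra_mul_comm_of_isUnit_det v w
    (T5InertGlobalPrime.finrank_adicCompletion_eq_two_of_staysPrime v w h2 hmap) hϖ
    (T5InertGlobalPrime.irreducible_algebraMap_of_staysPrime v w hmap hϖ) σ hσ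

/-- (u3) at a place `v` that stays prime in the quadratic `L / K`: `(L_w³, H)` admits a self-dual
`𝒪_{E_v}`-lattice iff `det H = a · ϖ^{2m}` with `a ∈ O_Kvˣ`
(`T5InertPlaceCompletionIsotropy.exists_dualLattice_eq_iff_exists_det_eq_mul_zpow_of_isUnit_det`
with its two local hypotheses discharged; no isotropy hypothesis). -/
theorem exists_dualLattice_eq_iff_of_staysPrime (h2 : Module.finrank K L = 2)
    (hmap : v.asIdeal.map (algebraMap (𝓞 K) (𝓞 L)) = w.asIdeal)
    {ϖ : v.adicCompletionIntegers K} (hϖ : Irreducible ϖ)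
    (σ : w.adicCompletion L ≃ₐ[v.adicCompletion K] w.adicCompletion L) (hσ : σ ≠ 1) :
    letI := T5StarOfInvolution.starRingOfQuadratic
      (T5InertGlobalPrime.finrank_adicCompletion_eq_two_of_staysPrime v w h2 hmap) σ hσ
    ∀ {H : Matrix (Fin 3) (Fin 3) (w.adicCompletion L)}, H.IsHermitian → IsUnit H.det →
    ((∃ Q : Matrix (Fin 3) (Fin 3) (w.adicCompletion L), IsUnit Q ∧
      T5UnitaryGroupIsometry.dualLattice
        (integralClosure (v.adicCompletionIntegers K) (w.adicCompletion L))
        (Q.conjTranspose * H * Q)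
        (T5UnitaryGroupIsometry.stdLattice
          (integralClosure (v.adicCompletionIntegers K) (w.adicCompletion L))) =
      T5UnitaryGroupIsometry.stdLattice
        (integralClosure (v.adicCompletionIntegers K) (w.adicCompletion L))) ↔
    ∃ (a : (v.adicCompletionIntegers K)ˣ) (m : ℤ),
      H.det = algebraMap (v.adicCompletionIntegers K) (w.adicCompletion L) a *
        algebraMap (v.adicCompletionIntegers K) (w.adicCompletion L) ϖ ^ (2 * m)) :=
  T5InertPlaceCompletionIsotropy.exists_dualLattice_eq_iff_exists_det_eq_mul_zpow_of_isUnit_det v w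
    (T5InertGlobalPrime.finrank_adicCompletion_eq_two_of_staysPrime v w h2 hmap) hϖ
    (T5InertGlobalPrime.irreducible_algebraMap_of_staysPrime v w hmap hϖ) σ hσ

/-- (u3) with the lattice over Mathlib's own `O_Lw = w.adicCompletionIntegers L`. -/
theorem exists_dualLattice_eq_iff_of_staysPrime' (h2 : Module.finrank K L = 2)
    (hmap : v.asIdeal.map (algebraMap (𝓞 K) (𝓞 L)) = w.asIdeal)
    {ϖ : v.adicCompletionIntegers K} (hϖ : Irreducible ϖ)
    (σ : w.adicCompletion L ≃ₐ[v.adicCompletion K] w.adicCompletion L) (hσ : σ ≠ 1) :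
    letI := T5StarOfInvolution.starRingOfQuadratic
      (T5InertGlobalPrime.finrank_adicCompletion_eq_two_of_staysPrime v w h2 hmap) σ hσ
    ∀ {H : Matrix (Fin 3) (Fin 3) (w.adicCompletion L)}, H.IsHermitian → IsUnit H.det →
    ((∃ Q : Matrix (Fin 3) (Fin 3) (w.adicCompletion L), IsUnit Q ∧
      T5UnitaryGroupIsometry.dualLattice (w.adicCompletionIntegers L) (Q.conjTranspose * H * Q)
        (T5UnitaryGroupIsometry.stdLattice (w.adicCompletionIntegers L)) =
      T5UnitaryGroupIsometry.stdLattice (w.adicCompletionIntegers L)) ↔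
    ∃ (a : (v.adicCompletionIntegers K)ˣ) (m : ℤ),
      H.det = algebraMap (v.adicCompletionIntegers K) (w.adicCompletion L) a *
        algebraMap (v.adicCompletionIntegers K) (w.adicCompletion L) ϖ ^ (2 * m)) :=
  T5InertPlaceCompletionIsotropy.exists_dualLattice_eq_iff_exists_det_eq_mul_zpow_of_isUnit_det' v w
    (T5InertGlobalPrime.finrank_adicCompletion_eq_two_of_staysPrime v w h2 hmap) hϖ
    (T5InertGlobalPrime.irreducible_algebraMap_of_staysPrime v w hmap hϖ) σ hσ

/-- The Galois conjugation needed by the three statements above exists at a place that stays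
prime in a quadratic extension. -/
theorem exists_algEquiv_ne_one (h2 : Module.finrank K L = 2)
    (hmap : v.asIdeal.map (algebraMap (𝓞 K) (𝓞 L)) = w.asIdeal) :
    ∃ σ : w.adicCompletion L ≃ₐ[v.adicCompletion K] w.adicCompletion L, σ ≠ 1 :=
  T5InertGlobalPrime.exists_algEquiv_ne_one_of_staysPrime v w h2 hmap

end Summit.Ventures.HodgeRepro2.T5InertPlaceGlobalPackage
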